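import Literature.InformationTheory.QuantumCodes.StabilizerLDPCErasureRateBound
import Literature.InformationTheory.QuantumCodes.AdditiveErasureErrorRadius
import HarnessLib

/-!
# Decoding error probability on the quantum erasure channel for STABILIZER codes: every decoder fails with
# probability `≥ ½·P[non-correctable]`, a minimum-weight decoder with probability `≤ P[non-correctable]`

Topic `Literature/InformationTheory/QuantumCodes` (venture QEC, LADDER-QEC rungs Q4/Q5; qec-lit-2 gen 7). This file links
the printed hypothesis of the erasure-channel converses — "achieving vanishing DECODING ERROR PROBABILITY" (Delfosse–Zémor
2013 Thm. 3.5/3.8; Bennett–DiVincenzo–Smolin 1997) — with the tree's decoder-free failure event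
`¬ IsCorrectableRegion S̄ M` used by `StabilizerErasureCapacity.lean` and `StabilizerLDPCErasureRateBound.lean`.

**Printed model** (Delfosse–Zémor 2013 §3.1): "each qubit is erased independently with probability `p`. An erased qubit
is subjected to a random Pauli error `I, X, Y` or `Z` with equal probability `1/4` and we know that this qubit is erased
… To recover the original quantum state, we compute the syndrome `σ ∈ 𝔽₂ʳ` and must deduce from the couple `(ℰ, σ)` an
error `Ẽ ⊂ ℰ` … If the errors `E` and `Ẽ` are in the same coset modulo `S`, then … the final quantum state is the
original state"; "when the erasure vector covers a problematic error, we will say that we have a non-correctable erasure".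
Lemma 3.6: given `ℰ = v` and the syndrome, the coset of `E` is uniform among `2^{h(v)}` cosets,
`h(v) = 2|v| − rank H + rank H_{v̄} − rank H_v`, so the optimal decoder fails with conditional probability `1 − 2^{−h(v)}`.

**Definitions** (two, with bodies; the tree's `SympErasureDecoder n Syn = Finset (Fin n) → Syn → SympVec n` and
`SympErasureDecoder.Corrects D syn S̄ Er e : D Er (syn e) + e ∈ S̄` of `AdditiveErasureErrorRadius.lean` are reused):
* `SympErasureDecoder.condFailure D syn S̄ M` — the conditional probability, given the erased set `M`, that `D` fails
  on a uniformly random Pauli error supported inside `M` (`#{e ∈ P(M) : ¬ Corrects}/#P(M)`);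
* `SympErasureDecoder.erasureFailureProb D syn S̄ p = Σ_M p^{|M|}(1−p)^{n−|M|}·condFailure D syn S̄ M` — the DECODING
  ERROR PROBABILITY of `D` on the quantum erasure channel of rate `p`.

**Results** (all PROVED here).
* `half_le_condFailure_of_not_isCorrectableRegion`: for every decoder of a syndrome map blind to `S̄⊥` and every
  non-correctable `M`, `condFailure ≥ ½` (pairing `e ↔ e + L` with a logical `L` inside `M`: the successes and their
  translates are disjoint) — the combinatorial content of Lemma 3.6; hence for `0 ≤ p ≤ 1`
  `½·P_p[non-correctable] ≤ erasureFailureProb D` (`half_mul_eventProb_le_erasureFailureProb`), EVERY decoder.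
* `IsMinWeightOutside.corrects_of_isCorrectableRegion`: a minimum-weight-outside-the-erasure decoder of the generator
  syndrome (Dumer–Kovalev–Pryadko) corrects every error inside a correctable erased set; so
  `erasureFailureProb ≤ P_p[non-correctable]` for it (`erasureFailureProb_le_eventProb_of_isMinWeightOutside`): the two
  thresholds coincide (`belowThreshold_iff_of_isMinWeightOutside`).
* Threshold transfer (`belowThreshold_erasure_of_decoder`, `isThresholdLowerBound_erasure_of_decoder`,
  `accuracyThreshold_decoder_le`): a below-threshold rate / threshold lower bound / accuracy threshold of ANY decoder family
  is one for the non-correctability event.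
* THE PRINTED HYPOTHESES: Bennett–DiVincenzo–Smolin's `R ≤ 1 − 2ε` (`stabilizer_quantumErasure_rate_le_of_decoder`),
  Delfosse–Zémor Thm. 3.8 (`DelfosseZemor_theorem38_of_decoder`) and the strict LDPC ceiling `ε_c(D) < (1 − R)/2`
  (`stabilizerLDPC_decoder_accuracyThreshold_lt`) for families of stabilizer codes with `k_i ≥ 1`, rate `≥ R`, and ANY
  erasure decoders `D_i` "achieving vanishing decoding error probability" at `p`.

* LEMMA 3.6 EXACTLY (appended, section `Exact`; self-orthogonal `S̄`, `A = S̄⊥ ⊓ P(M)`, `B = S̄ ⊓ P(M)`, `h(M) = dim A − dim B`):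
  `#successes · #A ≤ #P(M) · #B` for EVERY decoder (`card_successes_mul_card_le`: fibres of `(g, a) ↦ g + a` lie in one
  coset of `B`), with EQUALITY for minimum-weight-outside decoders (`IsMinWeightOutside.card_successes_mul_card_eq`); hence
  `condFailure ≥ 1 − 2^{dim B}/2^{dim A} = 1 − 2^{−h(M)}` for every decoder and `=` for minimum-weight decoders
  (`one_sub_two_pow_div_le_condFailure`, `IsMinWeightOutside.condFailure_eq`) — "the probability of a coset … is
  `2^{−2|v| + rank H − rank H_v̄ + rank H_v}`".
* THEOREM 3.5's DISPLAYED INEQUALITY (`DelfosseZemor_decodingError_ge`): for every decoder,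
  `(2np − rank H + 𝔼_p[rank H_ℰ̄ − rank H_ℰ] − 1)/(2n) ≤ P_err` (pointwise `(h − 1)/(2n) ≤ 1 − 2^{−h}` for `h ≤ 2n`
  replaces Fano's inequality; same constant).

Not claimed: randomised decoders (a randomised decoder is a mixture of deterministic ones, not formalised); the entropy
`H(X | ℰ, Σ)` itself.

## References

* [DelfosseZemor2013] N. Delfosse, G. Zémor, QIC 13 (2013) 793 = arXiv:1205.7036, §3.1 (chunk p0007 L33–L66: the
  channel, decoding from `(ℰ, σ)`, non-correctable erasure), §3.4 Lemma 3.6 (chunk p0009 L40–L70), Thm. 3.5, Thm. 3.8.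
* [BennettDivincenzoSmolin1997] C. H. Bennett, D. P. DiVincenzo, J. A. Smolin, PRL 78 (1997) 3217, p. 3218.
* [DumerKovalevPryadko2015] I. Dumer, A. A. Kovalev, L. P. Pryadko, PRL 115 (2015) 050502, p. 3 (minimum-weight decoding
  given the erasure).
* [Gottesman1997] D. Gottesman, PhD thesis, arXiv:quant-ph/9705052, §2.3 (located errors).
* [DennisEtAl2002] Dennis–Kitaev–Landahl–Preskill, J. Math. Phys. 43 (2002) 4452, §4.3, §4.6 (threshold).

## Mathlib / tree search

Tree: `SympErasureDecoder`, `SympErasureDecoder.Corrects`, `IsMinWeightOutside`, `minWeightOutside(_isMinWeightOutside)`,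
`sympSyndrome_eq_iff`, `sub_eq_add_sympVec`, `mem_sympSupport_iff` (AdditiveErasureErrorRadius / SyndromeDecodingAdditive);
`IsCorrectableRegion`, `supportedOn`, `mem_supportedOn_of_forall_sympSupport`; `eventProb_eq_sum_ite`, `bernoulliWeight_nonneg`,
`eventProb_nonneg`, `le_accuracyThreshold`, `isThresholdLowerBound_accuracyThreshold`, `accuracyThreshold_le_one`;
`stabilizer_quantumErasure_rate_le`, `DelfosseZemor_theorem38`, `stabilizerLDPC_erasure_accuracyThreshold_lt`.
`lean search 'erasureFailureProb|condFailure'`: no prior decoder-failure functional for symplectic erasure decoders (the CSS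
sector analogue is `ErasureDecoder.failureProb`, worst case inside the erasure, `ErasureDecoding.lean`).
-/

namespace Literature.InformationTheory.QuantumCodes

open Finset Filter Topology

variable {n : ℕ}

namespace SympErasureDecoder

variable {Syn : Type*}

/-! ### The decoding error probability of an erasure decoder -/

open Classical in
/-- **Conditional decoding failure given the erased set.** For an erasure decoder `D`, a syndrome map `syn` and the
stabilizer set `S̄`: the fraction of the Pauli errors `e` supported inside `M` ("`E ⊂ ℰ` … all errors `E ⊂ ℰ` occur with
the same probability") on which `D(M, syn e)` does not bring `e` back into `S̄`.
[cite: DelfosseZemor2013, §3.1 (chunk p0007 L40–L66)] -/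
noncomputable def condFailure (D : SympErasureDecoder n Syn) (syn : SympVec n → Syn) (S : Set (SympVec n))
    (M : Finset (Fin n)) : ℝ :=
  ((univ.filter fun e : SympVec n => e ∈ supportedOn M ∧ ¬ D.Corrects syn S M e).card : ℝ) /
    ((univ.filter fun e : SympVec n => e ∈ supportedOn M).card : ℝ)

open Classical in
/-- **Decoding error probability on the quantum erasure channel of rate `p`**: the erased set `M` is drawn with
probability `p^{|M|}(1−p)^{n−|M|}`, the error uniformly inside `M`, and `D` decodes from `(M, syn e)`.
[cite: DelfosseZemor2013, §3.1 (chunk p0007 L40–L60) and §3.4 (P_err, proof of Thm. 3.5)] -/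
noncomputable def erasureFailureProb (D : SympErasureDecoder n Syn) (syn : SympVec n → Syn) (S : Set (SympVec n))
    (p : ℝ) : ℝ :=
  ∑ M : Finset (Fin n), bernoulliWeight p M * D.condFailure syn S M

open Classical in
/-- Unfolding lemma for `erasureFailureProb`. [cite: DelfosseZemor2013, §3.1] -/
theorem erasureFailureProb_def (D : SympErasureDecoder n Syn) (syn : SympVec n → Syn) (S : Set (SympVec n)) (p : ℝ) :
    D.erasureFailureProb syn S p = ∑ M : Finset (Fin n), bernoulliWeight p M * D.condFailure syn S M := rfl

open Classical in
/-- The set of errors inside `M` is non-empty (it contains the identity). [cite: DelfosseZemor2013, §3.2 (2^{2|ℰ|} possible errors)] -/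
theorem card_filter_mem_supportedOn_pos (M : Finset (Fin n)) :
    0 < (univ.filter fun e : SympVec n => e ∈ supportedOn M).card :=
  Finset.card_pos.2 ⟨0, by simp⟩

/-- `0 ≤ condFailure`. [cite: DelfosseZemor2013, §3.1] -/
theorem condFailure_nonneg (D : SympErasureDecoder n Syn) (syn : SympVec n → Syn) (S : Set (SympVec n))
    (M : Finset (Fin n)) : 0 ≤ D.condFailure syn S M := by
  unfold condFailure
  positivity

open Classical in
/-- `condFailure ≤ 1`. [cite: DelfosseZemor2013, §3.1] -/
theorem condFailure_le_one (D : SympErasureDecoder n Syn) (syn : SympVec n → Syn) (S : Set (SympVec n))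
    (M : Finset (Fin n)) : D.condFailure syn S M ≤ 1 := by
  unfold condFailure
  have hpos : (0 : ℝ) < (univ.filter fun e : SympVec n => e ∈ supportedOn M).card := by
    exact_mod_cast card_filter_mem_supportedOn_pos M
  rw [div_le_one hpos]
  exact_mod_cast Finset.card_le_card (fun e he => by
    rw [mem_filter] at he ⊢
    exact ⟨he.1, he.2.1⟩)

/-- `0 ≤ erasureFailureProb` for `0 ≤ p ≤ 1`. [cite: DelfosseZemor2013, §3.1] -/
theorem erasureFailureProb_nonneg (D : SympErasureDecoder n Syn) (syn : SympVec n → Syn) (S : Set (SympVec n)) {p : ℝ}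
    (hp0 : 0 ≤ p) (hp1 : p ≤ 1) : 0 ≤ D.erasureFailureProb syn S p := by
  rw [erasureFailureProb_def]
  exact Finset.sum_nonneg fun M _ => mul_nonneg (bernoulliWeight_nonneg hp0 hp1 M) (D.condFailure_nonneg syn S M)

/-! ### Every decoder: `condFailure ≥ ½` on a non-correctable erased set (the pairing `e ↔ e + L`) -/

open Classical in
/-- **On a non-correctable erased set every decoder fails on at least half of the errors inside it.** If `M` contains a
logical operator `L ∈ (S̄⊥ ∩ P(M)) ∖ S̄` and the syndrome map is blind to `S̄⊥`, then `e ↦ e + L` maps the successes of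
`D` inside `M` injectively into its failures inside `M` (`D` answers the same correction `c` to both, and `c + e ∈ S̄`,
`c + e + L ∈ S̄` would force `L ∈ S̄`): `condFailure ≥ ½` — the combinatorial content of "the coset of `E` is uniform
among `2^{h(v)} ≥ 2` cosets". [cite: DelfosseZemor2013, §3.4 Lemma 3.6 (chunk p0009 L40–L70) and §3.2 (the example: "This erasure is not correctable")] -/
theorem half_le_condFailure_of_not_isCorrectableRegion {S : Submodule (ZMod 2) (SympVec n)}
    (D : SympErasureDecoder n Syn) (syn : SympVec n → Syn) (hsyn : ∀ v, ∀ L ∈ sympDual S, syn (v + L) = syn v)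
    {M : Finset (Fin n)} (hM : ¬ IsCorrectableRegion S M) :
    1 / 2 ≤ D.condFailure syn (S : Set (SympVec n)) M := by
  unfold IsCorrectableRegion at hM
  push Not at hM
  obtain ⟨L, hLd, hLM, hLS⟩ := hM
  set T := univ.filter (fun e : SympVec n => e ∈ supportedOn M) with hT
  set F := univ.filter (fun e : SympVec n => e ∈ supportedOn M ∧ ¬ D.Corrects syn (S : Set (SympVec n)) M e) with hF
  set G := univ.filter (fun e : SympVec n => e ∈ supportedOn M ∧ D.Corrects syn (S : Set (SympVec n)) M e) with hG
  have hTpos : (0 : ℝ) < T.card := by exact_mod_cast card_filter_mem_supportedOn_pos M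
  have hsplit : G.card + F.card = T.card := by
    have h := Finset.card_filter_add_card_filter_not
      (s := T) (fun e : SympVec n => D.Corrects syn (S : Set (SympVec n)) M e)
    rw [hT, Finset.filter_filter, Finset.filter_filter] at h
    rw [hG, hF, hT]
    exact h
  have hGF : G.card ≤ F.card := by
    refine Finset.card_le_card_of_injOn (fun e => e + L) (fun e he => ?_) (fun e _ e' _ h => add_right_cancel h)
    have he' : e ∈ G := he
    rw [hG, mem_filter] at he'
    show e + L ∈ F
    rw [hF, mem_filter]
    refine ⟨mem_univ _, Submodule.add_mem _ he'.2.1 hLM, fun hcorr => hLS ?_⟩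
    have hsucc : D M (syn e) + e ∈ S := he'.2.2
    have hcorr' : D M (syn (e + L)) + (e + L) ∈ S := hcorr
    rw [hsyn e L hLd] at hcorr'
    have hdiff := S.sub_mem hcorr' hsucc
    have heq : D M (syn e) + (e + L) - (D M (syn e) + e) = L := by abel
    rwa [heq] at hdiff
  unfold condFailure
  rw [← hF, ← hT, le_div_iff₀ hTpos]
  have h1 : ((G.card + F.card : ℕ) : ℝ) = T.card := by exact_mod_cast hsplit
  have h2 : (G.card : ℝ) ≤ F.card := by exact_mod_cast hGF
  push_cast at h1
  linarith

open Classical in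
/-- **EVERY decoder fails with probability at least `½·P_p[erasure non-correctable]`** (`0 ≤ p ≤ 1`, syndrome map blind
to `S̄⊥`): `½·P_p[¬ correctable] ≤ erasureFailureProb D`. So "vanishing decoding error probability" for ANY decoder
family forces the non-correctability probability to vanish. [cite: DelfosseZemor2013, §3.4 (proof of Thm. 3.5 via Lemma 3.6: P_err ≥ …)] -/
theorem half_mul_eventProb_le_erasureFailureProb {S : Submodule (ZMod 2) (SympVec n)} (D : SympErasureDecoder n Syn)
    (syn : SympVec n → Syn) (hsyn : ∀ v, ∀ L ∈ sympDual S, syn (v + L) = syn v) {p : ℝ} (hp0 : 0 ≤ p) (hp1 : p ≤ 1) :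
    1 / 2 * eventProb (fun M : Finset (Fin n) => ¬ IsCorrectableRegion S M) p ≤
      D.erasureFailureProb syn (S : Set (SympVec n)) p := by
  rw [eventProb_eq_sum_ite, Finset.mul_sum, erasureFailureProb_def]
  refine Finset.sum_le_sum fun M _ => ?_
  by_cases hM : IsCorrectableRegion S M
  · rw [if_neg (not_not.2 hM), mul_zero]
    exact mul_nonneg (bernoulliWeight_nonneg hp0 hp1 M) (D.condFailure_nonneg syn _ M)
  · rw [if_pos hM, mul_comm]
    exact mul_le_mul_of_nonneg_left (D.half_le_condFailure_of_not_isCorrectableRegion syn hsyn hM)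
      (bernoulliWeight_nonneg hp0 hp1 M)

/-! ### Minimum-weight-outside-the-erasure decoders fail only on non-correctable erased sets -/

/-- The support of a vector supported on `M` lies in `M`. [cite: BravyiTerhal2009, §2 (support of an operator)] -/
theorem sympSupport_subset_of_mem_supportedOn {M : Finset (Fin n)} {e : SympVec n} (he : e ∈ supportedOn M) :
    sympSupport e ⊆ M := by
  intro i hi
  by_contra hiM
  rw [mem_sympSupport_iff] at hi
  rcases hi with h | h
  · exact h (he i hiM).1
  · exact h (he i hiM).2

/-- **A minimum-weight-outside-the-erasure decoder corrects every error inside a correctable erased set** (generator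
syndrome `σ = sympSyndrome g`, `span g = S̄`): its answer `c` has no support outside `M` (the error itself has none),
`c + e ∈ S̄⊥ ∩ P(M)`, and correctability makes it a stabilizer. [cite: DumerKovalevPryadko2015, p. 3 (decoding given the erasure); DelfosseZemor2013, §3.1 ("If the errors E and Ẽ are in the same coset modulo S … the final quantum state is the original state")] -/
theorem IsMinWeightOutside.corrects_of_isCorrectableRegion {ι : Type*} {g : ι → SympVec n}
    {S : Submodule (ZMod 2) (SympVec n)} (hg : Submodule.span (ZMod 2) (Set.range g) = S)
    {D : SympErasureDecoder n (ι → ZMod 2)} (hD : D.IsMinWeightOutside g) {M : Finset (Fin n)}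
    (hM : IsCorrectableRegion S M) {e : SympVec n} (he : e ∈ supportedOn M) :
    D.Corrects (sympSyndrome g) (S : Set (SympVec n)) M e := by
  have hsynd := (hD M e).1
  have hmin := (hD M e).2 e rfl
  set c := D M (sympSyndrome g e) with hc
  have hN : c + e ∈ sympDual S := by
    have h1 := (sympSyndrome_eq_iff g c e).1 hsynd
    rw [hg, sub_eq_add_sympVec] at h1
    exact h1
  have he0 : (sympSupport e \ M).card = 0 := by
    rw [Finset.card_eq_zero, Finset.sdiff_eq_empty_iff_subset]
    exact sympSupport_subset_of_mem_supportedOn he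
  have hc0 : sympSupport c \ M = ∅ := by
    rw [← Finset.card_eq_zero]
    have : (sympSupport c \ M).card ≤ 0 := he0 ▸ hmin
    omega
  have hcM : c ∈ supportedOn M := by
    refine mem_supportedOn_of_forall_sympSupport fun q hq => ?_
    by_contra hqM
    have : q ∈ sympSupport c \ M := Finset.mem_sdiff.2 ⟨hq, hqM⟩
    rw [hc0] at this
    exact Finset.notMem_empty q this
  exact hM (c + e) hN (Submodule.add_mem _ hcM he)

open Classical in
/-- On a correctable erased set a minimum-weight-outside-the-erasure decoder has `condFailure = 0`.
[cite: DumerKovalevPryadko2015, p. 3; DelfosseZemor2013, §3.1] -/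
theorem IsMinWeightOutside.condFailure_eq_zero_of_isCorrectableRegion {ι : Type*} {g : ι → SympVec n}
    {S : Submodule (ZMod 2) (SympVec n)} (hg : Submodule.span (ZMod 2) (Set.range g) = S)
    {D : SympErasureDecoder n (ι → ZMod 2)} (hD : D.IsMinWeightOutside g) {M : Finset (Fin n)}
    (hM : IsCorrectableRegion S M) : D.condFailure (sympSyndrome g) (S : Set (SympVec n)) M = 0 := by
  unfold condFailure
  have h0 : (univ.filter fun e : SympVec n =>
      e ∈ supportedOn M ∧ ¬ D.Corrects (sympSyndrome g) (S : Set (SympVec n)) M e) = ∅ := by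
    rw [Finset.eq_empty_iff_forall_notMem]
    intro e he
    rw [mem_filter] at he
    exact he.2.2 (hD.corrects_of_isCorrectableRegion hg hM he.2.1)
  rw [h0, Finset.card_empty, Nat.cast_zero, zero_div]

open Classical in
/-- **A minimum-weight-outside-the-erasure decoder fails with probability at most `P_p[erasure non-correctable]`**
(`0 ≤ p ≤ 1`): together with `half_mul_eventProb_le_erasureFailureProb`, `½·P[nc] ≤ P_err ≤ P[nc]` — the decoding
threshold of the quantum erasure channel IS the non-correctability threshold. [cite: DelfosseZemor2013, §3.1 and §3.4; DumerKovalevPryadko2015, p. 3] -/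
theorem erasureFailureProb_le_eventProb_of_isMinWeightOutside {ι : Type*} {g : ι → SympVec n}
    {S : Submodule (ZMod 2) (SympVec n)} (hg : Submodule.span (ZMod 2) (Set.range g) = S)
    {D : SympErasureDecoder n (ι → ZMod 2)} (hD : D.IsMinWeightOutside g) {p : ℝ} (hp0 : 0 ≤ p) (hp1 : p ≤ 1) :
    D.erasureFailureProb (sympSyndrome g) (S : Set (SympVec n)) p ≤
      eventProb (fun M : Finset (Fin n) => ¬ IsCorrectableRegion S M) p := by
  rw [eventProb_eq_sum_ite, erasureFailureProb_def]
  refine Finset.sum_le_sum fun M _ => ?_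
  by_cases hM : IsCorrectableRegion S M
  · rw [if_neg (not_not.2 hM), hD.condFailure_eq_zero_of_isCorrectableRegion hg hM, mul_zero]
  · rw [if_pos hM]
    exact mul_le_of_le_one_right (bernoulliWeight_nonneg hp0 hp1 M) (D.condFailure_le_one _ _ M)

end SympErasureDecoder

/-! ### Threshold transfer: decoder failure versus non-correctability -/

section Transfer

variable {nq : ℕ → ℕ} (S : ∀ i, Submodule (ZMod 2) (SympVec (nq i))) {Syn : ℕ → Type*}
  (syn : ∀ i, SympVec (nq i) → Syn i) (D : ∀ i, SympErasureDecoder (nq i) (Syn i))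

open Classical in
/-- **If SOME decoder family has vanishing decoding error probability at `0 ≤ p ≤ 1`, the non-correctability probability
vanishes at `p`.** [cite: DelfosseZemor2013, §3.4 (achievable rate: vanishing error probability after decoding); DennisEtAl2002, §4.3] -/
theorem belowThreshold_erasure_of_decoder (hsyn : ∀ i v, ∀ L ∈ sympDual (S i), syn i (v + L) = syn i v) {p : ℝ}
    (hp0 : 0 ≤ p) (hp1 : p ≤ 1)
    (h : BelowThreshold (fun i q => (D i).erasureFailureProb (syn i) (S i : Set (SympVec (nq i))) q) p) :
    BelowThreshold (fun i q => eventProb (fun M : Finset (Fin (nq i)) => ¬ IsCorrectableRegion (S i) M) q) p := by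
  unfold BelowThreshold at h ⊢
  have h2 : Tendsto (fun i => 2 * (D i).erasureFailureProb (syn i) (S i : Set (SympVec (nq i))) p) atTop (𝓝 (2 * 0)) :=
    h.const_mul 2
  rw [mul_zero] at h2
  refine squeeze_zero (fun i => eventProb_nonneg _ hp0 hp1) (fun i => ?_) h2
  have := (D i).half_mul_eventProb_le_erasureFailureProb (syn i) (hsyn i) hp0 hp1
  linarith

open Classical in
/-- **A threshold lower bound `a ≤ 1` of a decoder family is a threshold lower bound for non-correctability.**
[cite: DelfosseZemor2013, §1 ("Equivalently, we will derive an upper bound on the decoding threshold"); DennisEtAl2002, §4.6] -/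
theorem isThresholdLowerBound_erasure_of_decoder (hsyn : ∀ i v, ∀ L ∈ sympDual (S i), syn i (v + L) = syn i v)
    {a : ℝ} (ha1 : a ≤ 1)
    (ha : IsThresholdLowerBound (fun i q => (D i).erasureFailureProb (syn i) (S i : Set (SympVec (nq i))) q) a) :
    IsThresholdLowerBound (fun i q => eventProb (fun M : Finset (Fin (nq i)) => ¬ IsCorrectableRegion (S i) M) q) a :=
  fun p hp0 hpa => belowThreshold_erasure_of_decoder S syn D hsyn hp0 (by linarith) (ha p hp0 hpa)

open Classical in
/-- **The erasure accuracy threshold of every decoder family is at most the non-correctability accuracy threshold.**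
[cite: DelfosseZemor2013, §1 and §3.4; DennisEtAl2002, §4.6 (p_c)] -/
theorem accuracyThreshold_decoder_le (hsyn : ∀ i v, ∀ L ∈ sympDual (S i), syn i (v + L) = syn i v) :
    accuracyThreshold (fun i q => (D i).erasureFailureProb (syn i) (S i : Set (SympVec (nq i))) q) ≤
      accuracyThreshold (fun i q => eventProb (fun M : Finset (Fin (nq i)) => ¬ IsCorrectableRegion (S i) M) q) :=
  le_accuracyThreshold
    (isThresholdLowerBound_erasure_of_decoder S syn D hsyn (accuracyThreshold_le_one _)
      (isThresholdLowerBound_accuracyThreshold _))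
    (accuracyThreshold_le_one _)

open Classical in
/-- **For minimum-weight-outside-the-erasure decoders the two thresholds coincide**: at `0 ≤ p ≤ 1` the decoding error
probability vanishes iff the non-correctability probability does (`½·P[nc] ≤ P_err ≤ P[nc]`).
[cite: DelfosseZemor2013, §3.1 and §3.4; DumerKovalevPryadko2015, p. 3] -/
theorem belowThreshold_iff_of_isMinWeightOutside {ι : ℕ → Type*} (g : ∀ i, ι i → SympVec (nq i))
    (hg : ∀ i, Submodule.span (ZMod 2) (Set.range (g i)) = S i) (DM : ∀ i, SympErasureDecoder (nq i) (ι i → ZMod 2))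
    (hDM : ∀ i, (DM i).IsMinWeightOutside (g i)) {p : ℝ} (hp0 : 0 ≤ p) (hp1 : p ≤ 1) :
    BelowThreshold (fun i q => (DM i).erasureFailureProb (sympSyndrome (g i)) (S i : Set (SympVec (nq i))) q) p ↔
      BelowThreshold (fun i q => eventProb (fun M : Finset (Fin (nq i)) => ¬ IsCorrectableRegion (S i) M) q) p := by
  have hsyn : ∀ i v, ∀ L ∈ sympDual (S i), sympSyndrome (g i) (v + L) = sympSyndrome (g i) v := by
    intro i v L hL
    rw [← hg i] at hL
    exact (sympSyndrome_eq_iff (g i) (v + L) v).2 (by rwa [add_sub_cancel_left])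
  refine ⟨belowThreshold_erasure_of_decoder S (fun i => sympSyndrome (g i)) DM hsyn hp0 hp1, fun h => ?_⟩
  unfold BelowThreshold at h ⊢
  exact squeeze_zero (fun i => (DM i).erasureFailureProb_nonneg _ _ hp0 hp1)
    (fun i => SympErasureDecoder.erasureFailureProb_le_eventProb_of_isMinWeightOutside (hg i) (hDM i) hp0 hp1) h

end Transfer

/-! ### The converses with the printed hypothesis "vanishing decoding error probability" -/

section Printed

variable {nq : ℕ → ℕ} (S : ∀ i, Submodule (ZMod 2) (SympVec (nq i))) {k d : ℕ → ℕ} {Syn : ℕ → Type*}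
  (syn : ∀ i, SympVec (nq i) → Syn i) (D : ∀ i, SympErasureDecoder (nq i) (Syn i))

/-- **`R ≤ 1 − 2ε` (Bennett–DiVincenzo–Smolin; Delfosse–Zémor Cor. 3.7) with decoders**: if a family of stabilizer codes
with `k_i ≥ 1` and rate `≥ R` has ANY erasure decoders (of syndrome maps blind to `S̄⊥`) with vanishing decoding error
probability at the erasure rate `0 ≤ ε ≤ 1`, then `2ε ≤ 1 − R`. [cite: BennettDivincenzoSmolin1997, p. 3218 (Q ≤ 1 − 2ε); DelfosseZemor2013, §3.4 Cor. 3.7 (achievable rates … satisfy R ≤ 1 − 2p)] -/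
theorem stabilizer_quantumErasure_rate_le_of_decoder (hcode : ∀ i, IsAdditiveCode (S i) (k i) (d i))
    (hk : ∀ i, 1 ≤ k i) {R : ℝ} (hR : ∀ i, R * (nq i : ℝ) ≤ k i)
    (hsyn : ∀ i v, ∀ L ∈ sympDual (S i), syn i (v + L) = syn i v) {ε : ℝ} (h0 : 0 ≤ ε) (h1 : ε ≤ 1)
    (h : BelowThreshold (fun i q => (D i).erasureFailureProb (syn i) (S i : Set (SympVec (nq i))) q) ε) :
    2 * ε ≤ 1 - R :=
  stabilizer_quantumErasure_rate_le S hcode hk hR h0 h1 (belowThreshold_erasure_of_decoder S syn D hsyn h0 h1 h)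

/-- **THEOREM 3.8 (Delfosse–Zémor) AS PRINTED, decoders included.** "Let `𝒞` be any family of stabilizer codes of rates at
least `R` and achieving vanishing decoding error probability over the quantum erasure channel of erasure probability `p`
[here: for SOME erasure decoders `D_i` of syndrome maps blind to `S̄⊥`, `0 ≤ p ≤ 1/2`, `k_i ≥ 1`]. Suppose furthermore that
every code `C ∈ 𝒞` has a set of generators of its stabilizer group whose weights are all upper bounded by `m`. Then"
`R·(1 − (1−2p)(1−p)^{m−1}) ≤ (1−2p)·(1 − (1−p)^{m−1})` (the printed quotient after division).
[cite: DelfosseZemor2013, §3.5 Thm. 3.8 (chunk p0009 L95–L104)] -/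
theorem DelfosseZemor_theorem38_of_decoder (hcode : ∀ i, IsAdditiveCode (S i) (k i) (d i)) (hk : ∀ i, 1 ≤ k i)
    {R : ℝ} (hR : ∀ i, R * (nq i : ℝ) ≤ k i) {m : ℕ}
    (hgen : ∀ i, ∃ G : Set (SympVec (nq i)), (∀ v ∈ G, sympWeight v ≤ m) ∧ Submodule.span (ZMod 2) G = S i)
    (hsyn : ∀ i v, ∀ L ∈ sympDual (S i), syn i (v + L) = syn i v) {p : ℝ} (hp0 : 0 ≤ p) (hp : p ≤ 1 / 2)
    (h : BelowThreshold (fun i q => (D i).erasureFailureProb (syn i) (S i : Set (SympVec (nq i))) q) p) :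
    R * (1 - (1 - 2 * p) * (1 - p) ^ (m - 1)) ≤ (1 - 2 * p) * (1 - (1 - p) ^ (m - 1)) :=
  DelfosseZemor_theorem38 S hcode hk hR hgen hp0 hp
    (belowThreshold_erasure_of_decoder S syn D hsyn hp0 (by linarith) h)

/-- **The LDPC erasure ceiling for every decoder family**: for a family of stabilizer codes with `k_i ≥ 1`, rate `≥ R`
with `0 < R < 1`, and generators of weight `≤ m`, the erasure accuracy threshold of EVERY decoder family (syndrome maps
blind to `S̄⊥`) is STRICTLY below the capacity value `(1 − R)/2`. [cite: DelfosseZemor2013, §1 ("cannot achieve the capacity of the quantum erasure channel … Equivalently … an upper bound on the decoding threshold") and §3.5 Thm. 3.8] -/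
theorem stabilizerLDPC_decoder_accuracyThreshold_lt (hcode : ∀ i, IsAdditiveCode (S i) (k i) (d i)) (hk : ∀ i, 1 ≤ k i)
    {R : ℝ} (hR0 : 0 < R) (hR1 : R < 1) (hR : ∀ i, R * (nq i : ℝ) ≤ k i) {m : ℕ}
    (hgen : ∀ i, ∃ G : Set (SympVec (nq i)), (∀ v ∈ G, sympWeight v ≤ m) ∧ Submodule.span (ZMod 2) G = S i)
    (hsyn : ∀ i v, ∀ L ∈ sympDual (S i), syn i (v + L) = syn i v) :
    accuracyThreshold (fun i q => (D i).erasureFailureProb (syn i) (S i : Set (SympVec (nq i))) q) < (1 - R) / 2 :=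
  lt_of_le_of_lt (accuracyThreshold_decoder_le S syn D hsyn)
    (stabilizerLDPC_erasure_accuracyThreshold_lt S hcode hk hR0 hR1 hR hgen)

end Printed

/-! ### Lemma 3.6 exactly: `#successes·#A ≤ #P(M)·#B`, equality for minimum-weight decoders; Theorem 3.5 as displayed -/

namespace SympErasureDecoder

section Exact

variable {Syn : Type*}

open Classical in
/-- The number of vectors in a subspace `W ≤ 𝔽₂ⁿ × 𝔽₂ⁿ` is `2^{dim W}`. [cite: DelfosseZemor2013, §3.3 (Lemmas 3.2–3.3: the sets are 𝔽₂-vector spaces, so their sizes are powers of 2)] -/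
theorem card_filter_mem_submodule_eq_two_pow (W : Submodule (ZMod 2) (SympVec n)) :
    (univ.filter fun v : SympVec n => v ∈ W).card = 2 ^ Module.finrank (ZMod 2) W := by
  rw [← Fintype.card_subtype, Module.card_eq_pow_finrank (K := ZMod 2) (V := W), ZMod.card]

open Classical in
/-- **The counting behind Lemma 3.6, every decoder.** For a self-orthogonal `S̄`, a syndrome map blind to `S̄⊥`, an
erased set `M`, `A = S̄⊥ ⊓ P(M)`, `B = S̄ ⊓ P(M)` and the set `G` of errors inside `M` that `D` corrects:
`#G · #A ≤ #P(M) · #B` — the map `(g, a) ↦ g + a` from `G × A` to `P(M)` has fibres inside one coset of `B` (two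
successes `g, g'` with `g − g' ∈ A` receive the same correction `c`, so `g − g' = (c+g) − (c+g') ∈ S̄ ∩ P(M) = B`).
[cite: DelfosseZemor2013, §3.4 Lemma 3.6 and its proof (chunk p0009 L40–L70)] -/
theorem card_successes_mul_card_le (S : Submodule (ZMod 2) (SympVec n)) (D : SympErasureDecoder n Syn)
    (syn : SympVec n → Syn) (hsyn : ∀ v, ∀ L ∈ sympDual S, syn (v + L) = syn v) (M : Finset (Fin n)) :
    (univ.filter fun e : SympVec n => e ∈ supportedOn M ∧ D.Corrects syn (S : Set (SympVec n)) M e).card *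
        (univ.filter fun a : SympVec n => a ∈ (sympDual S ⊓ supportedOn M : Submodule (ZMod 2) (SympVec n))).card ≤
      (univ.filter fun e : SympVec n => e ∈ supportedOn M).card *
        (univ.filter fun b : SympVec n => b ∈ (S ⊓ supportedOn M : Submodule (ZMod 2) (SympVec n))).card := by
  set G := univ.filter fun e : SympVec n => e ∈ supportedOn M ∧ D.Corrects syn (S : Set (SympVec n)) M e with hG
  set TA := univ.filter fun a : SympVec n => a ∈ (sympDual S ⊓ supportedOn M : Submodule (ZMod 2) (SympVec n))
    with hTA
  set TP := univ.filter fun e : SympVec n => e ∈ supportedOn M with hTP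
  set TB := univ.filter fun b : SympVec n => b ∈ (S ⊓ supportedOn M : Submodule (ZMod 2) (SympVec n)) with hTB
  -- the map (g, a) ↦ g + a : G × A → P(M)
  have hmaps : ∀ x ∈ G ×ˢ TA, (fun x : SympVec n × SympVec n => x.1 + x.2) x ∈ TP := by
    intro x hx
    rw [Finset.mem_product] at hx
    have h1 : x.1 ∈ supportedOn M := by
      have := hx.1; rw [hG, mem_filter] at this; exact this.2.1
    have h2 : x.2 ∈ supportedOn M := by
      have := hx.2; rw [hTA, mem_filter] at this; exact this.2.2
    rw [hTP, mem_filter]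
    exact ⟨mem_univ _, Submodule.add_mem _ h1 h2⟩
  -- every fibre has at most #B elements
  have hfib : ∀ b ∈ TP, ((G ×ˢ TA).filter fun x : SympVec n × SympVec n => x.1 + x.2 = b).card ≤ TB.card := by
    intro b _
    set F := (G ×ˢ TA).filter fun x : SympVec n × SympVec n => x.1 + x.2 = b with hF
    rcases F.eq_empty_or_nonempty with hFe | ⟨x₀, hx₀⟩
    · rw [hFe, Finset.card_empty]
      exact Nat.zero_le _
    have hx₀' := hx₀
    rw [hF, mem_filter, Finset.mem_product, hG, mem_filter, hTA, mem_filter] at hx₀'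
    obtain ⟨⟨⟨-, hg₀M, hg₀c⟩, -, hA₀⟩, hsum₀⟩ := hx₀'
    refine Finset.card_le_card_of_injOn (fun x => x.1 + x₀.1) (fun x hx => ?_) (fun x hx x' hx' h => ?_)
    · -- x.1 − x₀.1 ∈ A, same correction, hence ∈ S̄ ∩ P(M)
      have hx' : x ∈ F := hx
      rw [hF, mem_filter, Finset.mem_product, hG, mem_filter, hTA, mem_filter] at hx'
      obtain ⟨⟨⟨-, hgM, hgc⟩, -, hA⟩, hsum⟩ := hx'
      show x.1 + x₀.1 ∈ TB
      rw [hTB, mem_filter]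
      refine ⟨mem_univ _, ?_, Submodule.add_mem _ hgM hg₀M⟩
      -- x.1 + x₀.1 = x.2 + x₀.2 ∈ S̄⊥
      have hdiff : x.1 + x₀.1 = x.2 + x₀.2 := by
        have h1 : x.1 = b + x.2 := by
          rw [← hsum, add_assoc, add_self_sympVec, add_zero]
        have h2 : x₀.1 = b + x₀.2 := by
          rw [← hsum₀, add_assoc, add_self_sympVec, add_zero]
        rw [h1, h2]
        have h3 : b + x.2 + (b + x₀.2) = (b + b) + (x.2 + x₀.2) := by abel
        rw [h3, add_self_sympVec, zero_add]
      have hL : x.1 + x₀.1 ∈ sympDual S := by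
        rw [hdiff]
        exact Submodule.add_mem _ hA.1 hA₀.1
      -- same syndrome ⇒ same correction
      have hsame : syn x.1 = syn x₀.1 := by
        have := hsyn x₀.1 (x.1 + x₀.1) hL
        rwa [← add_assoc, add_comm x₀.1 x.1, add_assoc, add_self_sympVec, add_zero] at this
      have hc : D M (syn x.1) + x.1 ∈ S := hgc
      have hc₀ : D M (syn x₀.1) + x₀.1 ∈ S := hg₀c
      rw [hsame] at hc
      have := S.add_mem hc hc₀
      have heq : D M (syn x₀.1) + x.1 + (D M (syn x₀.1) + x₀.1) = x.1 + x₀.1 := by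
        have h3 : D M (syn x₀.1) + x.1 + (D M (syn x₀.1) + x₀.1) =
            (D M (syn x₀.1) + D M (syn x₀.1)) + (x.1 + x₀.1) := by abel
        rw [h3, add_self_sympVec, zero_add]
      rwa [heq] at this
    · -- injectivity: the first coordinate determines the second (x.2 = b + x.1)
      have hxF : x ∈ F := hx
      have hxF' : x' ∈ F := hx'
      rw [hF, mem_filter] at hxF hxF'
      have h1 : x.1 = x'.1 := add_right_cancel h
      have h2 : x.2 = x'.2 := by
        have e1 : x.2 = b + x.1 := by rw [← hxF.2, add_comm x.1 x.2, add_assoc, add_self_sympVec, add_zero]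
        have e2 : x'.2 = b + x'.1 := by rw [← hxF'.2, add_comm x'.1 x'.2, add_assoc, add_self_sympVec, add_zero]
        rw [e1, e2, h1]
      exact Prod.ext h1 h2
  have h := Finset.card_le_mul_card_image_of_maps_to hmaps TB.card hfib
  rw [Finset.card_product] at h
  linarith [h]

open Classical in
/-- **Lemma 3.6, every decoder**: on any erased set `M`, for a self-orthogonal `S̄` and a syndrome map blind to `S̄⊥`,
`condFailure ≥ 1 − 2^{dim B}/2^{dim A} = 1 − 2^{−h(M)}` with `A = S̄⊥ ⊓ P(M)`, `B = S̄ ⊓ P(M)` ("the probability of a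
coset `E.S` … is `|S_v|/|N(S)_v| = 2^{−2|v| + rank H − rank H_v̄ + rank H_v}`", so no estimate of the coset is right
with probability more than that). [cite: DelfosseZemor2013, §3.4 Lemma 3.6 (chunk p0009 L40–L70)] -/
theorem one_sub_two_pow_div_le_condFailure (S : Submodule (ZMod 2) (SympVec n)) (D : SympErasureDecoder n Syn)
    (syn : SympVec n → Syn) (hsyn : ∀ v, ∀ L ∈ sympDual S, syn (v + L) = syn v) (M : Finset (Fin n)) :
    1 - (2 : ℝ) ^ Module.finrank (ZMod 2) ↥(S ⊓ supportedOn M) /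
        (2 : ℝ) ^ Module.finrank (ZMod 2) ↥(sympDual S ⊓ supportedOn M) ≤
      D.condFailure syn (S : Set (SympVec n)) M := by
  have h := card_successes_mul_card_le S D syn hsyn M
  rw [card_filter_mem_submodule_eq_two_pow (sympDual S ⊓ supportedOn M),
    card_filter_mem_submodule_eq_two_pow (S ⊓ supportedOn M)] at h
  set G := univ.filter fun e : SympVec n => e ∈ supportedOn M ∧ D.Corrects syn (S : Set (SympVec n)) M e with hG
  set F := univ.filter fun e : SympVec n => e ∈ supportedOn M ∧ ¬ D.Corrects syn (S : Set (SympVec n)) M e with hF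
  set T := univ.filter fun e : SympVec n => e ∈ supportedOn M with hT
  have hTpos : (0 : ℝ) < T.card := by exact_mod_cast card_filter_mem_supportedOn_pos M
  have hsplit : G.card + F.card = T.card := by
    have h' := Finset.card_filter_add_card_filter_not
      (s := T) (fun e : SympVec n => D.Corrects syn (S : Set (SympVec n)) M e)
    rw [hT, Finset.filter_filter, Finset.filter_filter] at h'
    rw [hG, hF, hT]
    exact h'
  have hA : (0 : ℝ) < (2 : ℝ) ^ Module.finrank (ZMod 2) ↥(sympDual S ⊓ supportedOn M) := by positivity
  unfold condFailure
  rw [← hF, ← hT]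
  have h1 : (G.card : ℝ) * (2 : ℝ) ^ Module.finrank (ZMod 2) ↥(sympDual S ⊓ supportedOn M) ≤
      (T.card : ℝ) * (2 : ℝ) ^ Module.finrank (ZMod 2) ↥(S ⊓ supportedOn M) := by exact_mod_cast h
  have h2 : ((G.card + F.card : ℕ) : ℝ) = T.card := by exact_mod_cast hsplit
  push_cast at h2
  have hGT : (G.card : ℝ) / T.card ≤
      (2 : ℝ) ^ Module.finrank (ZMod 2) ↥(S ⊓ supportedOn M) / (2 : ℝ) ^ Module.finrank (ZMod 2) ↥(sympDual S ⊓ supportedOn M) := by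
    rw [div_le_div_iff₀ hTpos hA]
    linarith [h1]
  have hFT : (F.card : ℝ) / T.card = 1 - G.card / T.card := by
    field_simp
    linarith [h2]
  rw [hFT]
  linarith

open Classical in
/-- **Lemma 3.6, equality for minimum-weight decoders.** For a self-orthogonal `S̄ = span g` and a
minimum-weight-outside-the-erasure decoder of the generator syndrome, `#G · #A = #P(M) · #B`: the map
`(x, b) ↦ (c(x) + b, x + c(x) + b)`, `c(x) = D(M, σ(x))`, injects `P(M) × B` into the fibres.
[cite: DelfosseZemor2013, §3.4 Lemma 3.6 (the coset is uniform among 2^{h} cosets; a consistent estimate attains 2^{−h})] -/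
theorem IsMinWeightOutside.card_successes_mul_card_eq {ι : Type*} {g : ι → SympVec n}
    {S : Submodule (ZMod 2) (SympVec n)} (hself : IsSelfOrthogonal S) (hg : Submodule.span (ZMod 2) (Set.range g) = S)
    {D : SympErasureDecoder n (ι → ZMod 2)} (hD : D.IsMinWeightOutside g) (M : Finset (Fin n)) :
    (univ.filter fun e : SympVec n =>
          e ∈ supportedOn M ∧ D.Corrects (sympSyndrome g) (S : Set (SympVec n)) M e).card *
        (univ.filter fun a : SympVec n => a ∈ (sympDual S ⊓ supportedOn M : Submodule (ZMod 2) (SympVec n))).card =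
      (univ.filter fun e : SympVec n => e ∈ supportedOn M).card *
        (univ.filter fun b : SympVec n => b ∈ (S ⊓ supportedOn M : Submodule (ZMod 2) (SympVec n))).card := by
  have hsyn : ∀ v, ∀ L ∈ sympDual S, sympSyndrome g (v + L) = sympSyndrome g v := by
    intro v L hL
    rw [← hg] at hL
    exact (sympSyndrome_eq_iff g (v + L) v).2 (by rwa [add_sub_cancel_left])
  refine le_antisymm (card_successes_mul_card_le S D (sympSyndrome g) hsyn M) ?_
  set G := univ.filter fun e : SympVec n =>
    e ∈ supportedOn M ∧ D.Corrects (sympSyndrome g) (S : Set (SympVec n)) M e with hG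
  set TA := univ.filter fun a : SympVec n => a ∈ (sympDual S ⊓ supportedOn M : Submodule (ZMod 2) (SympVec n))
    with hTA
  set TP := univ.filter fun e : SympVec n => e ∈ supportedOn M with hTP
  set TB := univ.filter fun b : SympVec n => b ∈ (S ⊓ supportedOn M : Submodule (ZMod 2) (SympVec n)) with hTB
  -- facts about the correction c(x) = D M (σ x) for x ∈ P(M): c(x) ∈ P(M) and c(x) + x ∈ S̄⊥
  have hcP : ∀ x : SympVec n, x ∈ supportedOn M → D M (sympSyndrome g x) ∈ supportedOn M := by
    intro x hx
    have hmin := (hD M x).2 x rfl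
    have hx0 : (sympSupport x \ M).card = 0 := by
      rw [Finset.card_eq_zero, Finset.sdiff_eq_empty_iff_subset]
      exact sympSupport_subset_of_mem_supportedOn hx
    have hc0 : sympSupport (D M (sympSyndrome g x)) \ M = ∅ := by
      rw [← Finset.card_eq_zero]
      have : (sympSupport (D M (sympSyndrome g x)) \ M).card ≤ 0 := hx0 ▸ hmin
      omega
    refine mem_supportedOn_of_forall_sympSupport fun q hq => ?_
    by_contra hqM
    have : q ∈ sympSupport (D M (sympSyndrome g x)) \ M := Finset.mem_sdiff.2 ⟨hq, hqM⟩
    rw [hc0] at this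
    exact Finset.notMem_empty q this
  have hcA : ∀ x : SympVec n, D M (sympSyndrome g x) + x ∈ sympDual S := by
    intro x
    have h1 := (sympSyndrome_eq_iff g (D M (sympSyndrome g x)) x).1 (hD M x).1
    rw [hg, sub_eq_add_sympVec] at h1
    exact h1
  -- the injection (x, b) ↦ (c(x) + b, x + c(x) + b) : P(M) × B → G × A, landing in the fibre over x
  rw [← Finset.card_product, ← Finset.card_product]
  refine Finset.card_le_card_of_injOn
    (fun y : SympVec n × SympVec n => (D M (sympSyndrome g y.1) + y.2, y.1 + D M (sympSyndrome g y.1) + y.2))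
    (fun y hy => ?_) (fun y hy y' hy' h => ?_)
  · have hy' : y ∈ TP ×ˢ TB := hy
    rw [Finset.mem_product, hTP, mem_filter, hTB, mem_filter] at hy'
    obtain ⟨⟨-, hxM⟩, -, hbS, hbM⟩ := hy'
    set c := D M (sympSyndrome g y.1) with hc
    have hcM := hcP y.1 hxM
    show (c + y.2, y.1 + c + y.2) ∈ G ×ˢ TA
    rw [Finset.mem_product, hG, mem_filter, hTA, mem_filter]
    refine ⟨⟨mem_univ _, Submodule.add_mem _ hcM hbM, ?_⟩, mem_univ _, ?_, ?_⟩
    · -- D succeeds on c + b: same syndrome as y.1, answer c, and c + (c + b) = b ∈ S̄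
      show D M (sympSyndrome g (c + y.2)) + (c + y.2) ∈ (S : Set (SympVec n))
      have hs1 : sympSyndrome g (c + y.2) = sympSyndrome g c := hsyn c y.2 (hself hbS)
      have hs2 : sympSyndrome g c = sympSyndrome g y.1 := by
        have := hsyn y.1 (c + y.1) (hcA y.1)
        rwa [← add_assoc, add_comm y.1 c, add_assoc, add_self_sympVec, add_zero] at this
      rw [hs1, hs2, ← hc, ← add_assoc, add_self_sympVec, zero_add]
      exact hbS
    · -- y.1 + c + y.2 ∈ S̄⊥
      have h1 : y.1 + c ∈ sympDual S := by rw [add_comm]; exact hcA y.1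
      exact Submodule.add_mem _ h1 (hself hbS)
    · exact Submodule.add_mem _ (Submodule.add_mem _ hxM hcM) hbM
  · -- injectivity: adding the two components recovers y.1
    have h1 : D M (sympSyndrome g y.1) + y.2 = D M (sympSyndrome g y'.1) + y'.2 := congrArg Prod.fst h
    have h2 : y.1 + D M (sympSyndrome g y.1) + y.2 = y'.1 + D M (sympSyndrome g y'.1) + y'.2 := congrArg Prod.snd h
    have key : ∀ u c b : SympVec n, u + c + b + (c + b) = u := by
      intro u c b
      have e : u + c + b + (c + b) = u + ((c + c) + (b + b)) := by abel
      rw [e, add_self_sympVec, add_self_sympVec, add_zero, add_zero]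
    have hx : y.1 = y'.1 := by
      rw [← key y.1 (D M (sympSyndrome g y.1)) y.2, h2, h1, key]
    have hb : y.2 = y'.2 := by
      rw [hx] at h1
      exact add_left_cancel h1
    exact Prod.ext hx hb

open Classical in
/-- **Lemma 3.6 exactly for minimum-weight decoders**: `condFailure = 1 − 2^{dim B}/2^{dim A} = 1 − 2^{−h(M)}` — "hence
`H(X | ℰ = v, Σ = y) = 2|v| − rank H + rank H_v̄ − rank H_v`": the optimal conditional failure probability.
[cite: DelfosseZemor2013, §3.4 Lemma 3.6 (chunk p0009 L40–L70)] -/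
theorem IsMinWeightOutside.condFailure_eq {ι : Type*} {g : ι → SympVec n} {S : Submodule (ZMod 2) (SympVec n)}
    (hself : IsSelfOrthogonal S) (hg : Submodule.span (ZMod 2) (Set.range g) = S)
    {D : SympErasureDecoder n (ι → ZMod 2)} (hD : D.IsMinWeightOutside g) (M : Finset (Fin n)) :
    D.condFailure (sympSyndrome g) (S : Set (SympVec n)) M =
      1 - (2 : ℝ) ^ Module.finrank (ZMod 2) ↥(S ⊓ supportedOn M) /
        (2 : ℝ) ^ Module.finrank (ZMod 2) ↥(sympDual S ⊓ supportedOn M) := by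
  have h := hD.card_successes_mul_card_eq hself hg M
  rw [card_filter_mem_submodule_eq_two_pow (sympDual S ⊓ supportedOn M),
    card_filter_mem_submodule_eq_two_pow (S ⊓ supportedOn M)] at h
  set G := univ.filter fun e : SympVec n =>
    e ∈ supportedOn M ∧ D.Corrects (sympSyndrome g) (S : Set (SympVec n)) M e with hG
  set F := univ.filter fun e : SympVec n =>
    e ∈ supportedOn M ∧ ¬ D.Corrects (sympSyndrome g) (S : Set (SympVec n)) M e with hF
  set T := univ.filter fun e : SympVec n => e ∈ supportedOn M with hT
  have hTpos : (0 : ℝ) < T.card := by exact_mod_cast card_filter_mem_supportedOn_pos M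
  have hsplit : G.card + F.card = T.card := by
    have h' := Finset.card_filter_add_card_filter_not
      (s := T) (fun e : SympVec n => D.Corrects (sympSyndrome g) (S : Set (SympVec n)) M e)
    rw [hT, Finset.filter_filter, Finset.filter_filter] at h'
    rw [hG, hF, hT]
    exact h'
  have hA : (0 : ℝ) < (2 : ℝ) ^ Module.finrank (ZMod 2) ↥(sympDual S ⊓ supportedOn M) := by positivity
  unfold condFailure
  rw [← hF, ← hT]
  have h1 : (G.card : ℝ) * (2 : ℝ) ^ Module.finrank (ZMod 2) ↥(sympDual S ⊓ supportedOn M) =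
      (T.card : ℝ) * (2 : ℝ) ^ Module.finrank (ZMod 2) ↥(S ⊓ supportedOn M) := by exact_mod_cast h
  have h2 : ((G.card + F.card : ℕ) : ℝ) = T.card := by exact_mod_cast hsplit
  push_cast at h2
  have hGT : (G.card : ℝ) / T.card =
      (2 : ℝ) ^ Module.finrank (ZMod 2) ↥(S ⊓ supportedOn M) / (2 : ℝ) ^ Module.finrank (ZMod 2) ↥(sympDual S ⊓ supportedOn M) := by
    rw [div_eq_div_iff hTpos.ne' hA.ne']
    linarith [h1]
  have hFT : (F.card : ℝ) / T.card = 1 - G.card / T.card := by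
    field_simp
    linarith [h2]
  rw [hFT, hGT]

/-! ### Theorem 3.5 as displayed: `P_err ≥ (2np − rank H + 𝔼_p(rank H_ℰ̄ − rank H_ℰ) − 1)/(2n)` -/

/-- Fano's step, replaced by an elementary inequality: for integers `0 ≤ h ≤ N` (`N ≥ 1`),
`(h − 1)/N ≤ 1 − 2^{−h}` (`2^h ≥ h + 1` and `h ≤ N`). [cite: DelfosseZemor2013, §3.4 (Fano's inequality P_err ≥ (H(X|Y) − 1)/log|𝒳|, denominator bounded by 2n)] -/
theorem sub_one_div_le_one_sub_two_pow_inv {h N : ℕ} (hle : h ≤ N) (hN : 0 < N) :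
    ((h : ℝ) - 1) / N ≤ 1 - 1 / (2 : ℝ) ^ h := by
  have hN' : (0 : ℝ) < N := by exact_mod_cast hN
  have hpow : (h : ℝ) + 1 ≤ (2 : ℝ) ^ h := by exact_mod_cast Nat.lt_two_pow_self
  have hle' : (h : ℝ) ≤ N := by exact_mod_cast hle
  have h1 : 1 / (2 : ℝ) ^ h ≤ 1 / ((h : ℝ) + 1) := one_div_le_one_div_of_le (by positivity) hpow
  have h0 : (0 : ℝ) ≤ h := Nat.cast_nonneg _
  have h2 : ((h : ℝ) - 1) / N ≤ (h : ℝ) / ((h : ℝ) + 1) := by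
    rw [div_le_div_iff₀ hN' (by positivity)]
    nlinarith [hle', hN', h0]
  have h3 : (h : ℝ) / ((h : ℝ) + 1) = 1 - 1 / ((h : ℝ) + 1) := by
    field_simp
    ring
  linarith

open Classical in
/-- **THEOREM 3.5 (Delfosse–Zémor) AS DISPLAYED IN ITS PROOF**: for a self-orthogonal `S̄ ≤ 𝔽₂ⁿ × 𝔽₂ⁿ`, EVERY erasure
decoder of a syndrome map blind to `S̄⊥`, and `0 ≤ p ≤ 1`:
`(2pn − dim S̄ + (K(1−p) − K(p)) − 1)/(2n) ≤ P_err(D)`, i.e. the printed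
"`P_err ≥ (2np − rank H + 𝔼_p(rank H_ℰ̄ − rank H_ℰ) − 1)/(2n)`" (`𝔼_p(rank H_ℰ̄ − rank H_ℰ) = K(1−p) − K(p)` by Lemma
3.3). Summing `condFailure ≥ 1 − 2^{−h(M)} ≥ (h(M) − 1)/(2n)` with `𝔼 h = 2pn − dim S̄ + K(1−p) − K(p)`
(exact cleaning count). [cite: DelfosseZemor2013, §3.4 Thm. 3.5, proof (chunk p0009 L1–L36)] -/
theorem DelfosseZemor_decodingError_ge {S : Submodule (ZMod 2) (SympVec n)} (hself : IsSelfOrthogonal S)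
    (D : SympErasureDecoder n Syn) (syn : SympVec n → Syn) (hsyn : ∀ v, ∀ L ∈ sympDual S, syn (v + L) = syn v)
    {p : ℝ} (hp0 : 0 ≤ p) (hp1 : p ≤ 1) :
    (2 * p * n - Module.finrank (ZMod 2) S +
        (∑ M : Finset (Fin n), bernoulliWeight (1 - p) M * (Module.finrank (ZMod 2) ↥(S ⊓ supportedOn M) : ℝ) -
          ∑ M : Finset (Fin n), bernoulliWeight p M * (Module.finrank (ZMod 2) ↥(S ⊓ supportedOn M) : ℝ)) - 1) /
        (2 * n) ≤
      D.erasureFailureProb syn (S : Set (SympVec n)) p := by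
  rcases Nat.eq_zero_or_pos n with hn | hn
  · subst hn
    simp only [Nat.cast_zero, mul_zero, div_zero]
    exact D.erasureFailureProb_nonneg syn _ hp0 hp1
  have hn2 : 0 < 2 * n := by omega
  have hn2' : (0 : ℝ) < 2 * n := by exact_mod_cast hn2
  -- pointwise: w(M)·(h(M) − 1)/(2n) ≤ w(M)·condFailure(M), h(M) = dim A − dim B
  have hpt : ∀ M : Finset (Fin n), bernoulliWeight p M *
      (((Module.finrank (ZMod 2) ↥(sympDual S ⊓ supportedOn M) : ℝ) -
        Module.finrank (ZMod 2) ↥(S ⊓ supportedOn M) - 1) / (2 * n)) ≤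
      bernoulliWeight p M * D.condFailure syn (S : Set (SympVec n)) M := by
    intro M
    refine mul_le_mul_of_nonneg_left ?_ (bernoulliWeight_nonneg hp0 hp1 M)
    have hBA : Module.finrank (ZMod 2) ↥(S ⊓ supportedOn M) ≤ Module.finrank (ZMod 2) ↥(sympDual S ⊓ supportedOn M) :=
      Submodule.finrank_mono (inf_le_inf_right _ hself)
    have hA2n : Module.finrank (ZMod 2) ↥(sympDual S ⊓ supportedOn M) ≤ 2 * n := by
      have h1 : Module.finrank (ZMod 2) ↥(sympDual S ⊓ supportedOn M) ≤ Module.finrank (ZMod 2) ↥(supportedOn M) :=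
        Submodule.finrank_mono inf_le_right
      have h2 := finrank_supportedOn_le M
      have h3 := M.card_le_univ
      rw [Fintype.card_fin] at h3
      omega
    obtain ⟨h, hh⟩ : ∃ h : ℕ, Module.finrank (ZMod 2) ↥(sympDual S ⊓ supportedOn M) =
        Module.finrank (ZMod 2) ↥(S ⊓ supportedOn M) + h := Nat.exists_eq_add_of_le hBA
    have hkey := sub_one_div_le_one_sub_two_pow_inv (h := h) (N := 2 * n) (by omega) hn2
    push_cast at hkey
    have hLB := one_sub_two_pow_div_le_condFailure S D syn hsyn M
    have hB : (0 : ℝ) < (2 : ℝ) ^ Module.finrank (ZMod 2) ↥(S ⊓ supportedOn M) := by positivity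
    rw [hh, pow_add, ← div_div, div_self hB.ne'] at hLB
    rw [hh]
    push_cast
    have : ((Module.finrank (ZMod 2) ↥(S ⊓ supportedOn M) : ℝ) + h - Module.finrank (ZMod 2) ↥(S ⊓ supportedOn M) - 1) /
        (2 * n) = ((h : ℝ) - 1) / (2 * n) := by
      ring
    rw [this]
    exact hkey.trans hLB
  have hsum := Finset.sum_le_sum fun M (_ : M ∈ (univ : Finset (Finset (Fin n)))) => hpt M
  rw [← erasureFailureProb_def] at hsum
  refine le_trans (le_of_eq ?_) hsum
  -- the left-hand sum: Σ_M w(M)(dim A − dim B − 1)/(2n) = (2pn − s + K(1−p) − K(p) − 1)/(2n)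
  have hA : ∀ M : Finset (Fin n), (Module.finrank (ZMod 2) ↥(sympDual S ⊓ supportedOn M) : ℝ) =
      2 * (M.card : ℝ) + Module.finrank (ZMod 2) ↥(S ⊓ supportedOn Mᶜ) - Module.finrank (ZMod 2) S := by
    intro M
    have := finrank_sympDual_inf_supportedOn_add S M
    have h' : ((Module.finrank (ZMod 2) ↥(sympDual S ⊓ supportedOn M) + Module.finrank (ZMod 2) S : ℕ) : ℝ) =
        ((2 * M.card + Module.finrank (ZMod 2) ↥(S ⊓ supportedOn Mᶜ) : ℕ) : ℝ) := by exact_mod_cast this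
    push_cast at h'
    linarith
  simp_rw [hA]
  have hsplit : ∀ M : Finset (Fin n), bernoulliWeight p M *
      ((2 * (M.card : ℝ) + Module.finrank (ZMod 2) ↥(S ⊓ supportedOn Mᶜ) - Module.finrank (ZMod 2) S -
        Module.finrank (ZMod 2) ↥(S ⊓ supportedOn M) - 1) / (2 * n)) =
      (2 * (bernoulliWeight p M * M.card) + bernoulliWeight p M * Module.finrank (ZMod 2) ↥(S ⊓ supportedOn Mᶜ) -
        bernoulliWeight p M * (Module.finrank (ZMod 2) S + 1) -
        bernoulliWeight p M * Module.finrank (ZMod 2) ↥(S ⊓ supportedOn M)) / (2 * n) := by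
    intro M
    ring
  rw [Finset.sum_congr rfl fun M _ => hsplit M, ← Finset.sum_div]
  congr 1
  rw [Finset.sum_sub_distrib, Finset.sum_sub_distrib, Finset.sum_add_distrib, ← Finset.mul_sum,
    sum_bernoulliWeight_mul_card, Fintype.card_fin,
    sum_bernoulliWeight_mul_apply_compl p (fun M => (Module.finrank (ZMod 2) ↥(S ⊓ supportedOn M) : ℝ)),
    ← Finset.sum_mul, sum_bernoulliWeight, one_mul]
  ring

end Exact

end SympErasureDecoder

end Literature.InformationTheory.QuantumCodes
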